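import Summits.CriticalPhenomena.CardyFormulaZ2.Theorems.CardyFlipRussoSquareFromVoronoiHubDilutionDefs
import HarnessLib

/-!
# The minimal residual of the line `poisson-dilution-leg`: the ENDPOINT COMPARISON
# (crux `SquareFromVoronoiHub`, stmt-CriticalPhenomena-6434, route `CardyFlipRusso`, sub-problem `CardyFormulaZ2`; lead c6)

Helper file (`--supports stmt-CriticalPhenomena-6434`) of the line `poisson-dilution-leg`
(skeleton `Cruxes/SquareFromVoronoiHub/Lines/poisson_dilution_leg.lean`, definitions module
`…SquareFromVoronoiHubDilutionDefs`).  Skeleton v2 (lead c5) closed the crux modulo ONE registered stub,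
`stub_dilutionLegConstancy`: asymptotic constancy of the annealed crossing probabilities `legProb t` UNIFORMLY
along the whole leg `t ∈ [0,1]`.  The glue `dilutionLeg_transfer` consumes that hypothesis only at the two ends
`(t, t') = (1, 0)`.  This file records the exact statement the composition needs and nothing more:

* `endpointComparison_of_legConstancy` — the uniform leg constancy (v2's stub, the form the intended
  Russo–Mecke + mean-value proof delivers) implies the ENDPOINT COMPARISON
  `|legProb 1 − legProb 0| ≤ ε` eventually as `δ → 0⁺` (instantiate `t = 1`, `t' = 0`);
* `dilutionEndpoint_transfer` / `squareFromVoronoiHub_of_dilutionEndpoint` / registered glue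
  `stub_dilutionEndpointGlue` — hypothesis end + endpoint comparison + lattice end give the crux BY NAME;
* `endpointComparison_of_hasCrossingLimit` — conversely, if both endpoint families have Cardy (or any common)
  crossing limits for a conformal rectangle that admits a uniformizing datum, the endpoint comparison holds for
  it (Rényi–Kingman uniqueness of the Poisson laws of intensity `volume` and `0` reduces the quantifiers over the
  admissible pairs to the two unique laws).  So, given the two LANDED ends of the leg, the registered residual of
  skeleton v3 is exactly the crux's own `ε–δ` content — no spurious uniformity in `t` is asked of a disprover or of
  the planner who files it.

No new objects; vocabulary of `…DilutionDefs` only.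
-/

noncomputable section

open scoped Topology
open MeasureTheory Metric Set Filter
open Literature.Analysis.FunctionSpaces (PointConfig IsPoissonPointProcess
  existsUnique_isPoissonPointProcess_holds)
open Literature.Probability.RandomPlanarGeometry (ConformalRectangle cardyFunction crossRatio)
open Summit.CriticalPhenomena.CardyFormulaZ2.Cruxes.SquareFromVoronoiHub.VoronoiBlocks
  (siteCrossingProb voronoiCrossingProb squareFromVoronoiHub_iff)

namespace Summit.CriticalPhenomena.CardyFormulaZ2.Cruxes.SquareFromVoronoiHub.PoissonDilutionLeg

/-! ### Leg constancy ⟹ endpoint comparison -/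

/-- **Uniform leg constancy implies the endpoint comparison**: instantiate skeleton v2's stub
`stub_dilutionLegConstancy` at the two ends `t = 1` (Poisson pair of intensity `volume`) and `t' = 0`
(Poisson pair of intensity `0`). [folklore] -/
theorem endpointComparison_of_legConstancy
    (hK : ∀ R : ConformalRectangle, ∀ ε > (0 : ℝ), ∀ᶠ δ in 𝓝[>] (0 : ℝ),
      ∀ (t t' : unitInterval) (PB PW PB' PW' : Measure (PointConfig ℂ)),
        IsPoissonPointProcess (ENNReal.ofReal (t : ℝ) • (volume : Measure ℂ)) PB →
        IsPoissonPointProcess (ENNReal.ofReal (t : ℝ) • (volume : Measure ℂ)) PW →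
        IsPoissonPointProcess (ENNReal.ofReal (t' : ℝ) • (volume : Measure ℂ)) PB' →
        IsPoissonPointProcess (ENNReal.ofReal (t' : ℝ) • (volume : Measure ℂ)) PW' →
          |legProb t PB PW R δ - legProb t' PB' PW' R δ| ≤ ε) :
    ∀ R : ConformalRectangle, ∀ ε > (0 : ℝ), ∀ᶠ δ in 𝓝[>] (0 : ℝ),
      ∀ (PB PW PB' PW' : Measure (PointConfig ℂ)),
        IsPoissonPointProcess (volume : Measure ℂ) PB → IsPoissonPointProcess (volume : Measure ℂ) PW →
        IsPoissonPointProcess (0 : Measure ℂ) PB' → IsPoissonPointProcess (0 : Measure ℂ) PW' →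
          |legProb 1 PB PW R δ - legProb 0 PB' PW' R δ| ≤ ε := by
  intro R ε hε
  filter_upwards [hK R ε hε] with δ hδ PB PW PB' PW' hPB hPW hPB' hPW'
  refine hδ 1 0 PB PW PB' PW' ?_ ?_ ?_ ?_
  · simpa using hPB
  · simpa using hPW
  · simpa using hPB'
  · simpa using hPW'

/-! ### Endpoint comparison ⟹ crux (the minimal glue) -/

/-- **The transfer through the two ENDS of the Poisson-dilution leg** (crux unfolded).  If (H) under the
crux's hypothesis the `t = 1` leg probabilities tend to Cardy's value for every conformal rectangle (hypothesis
end, landed as `stub_dilutionHypothesisEnd`), (C) the `t = 1` and `t = 0` leg probabilities are eventually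
`ε`-close as `δ → 0⁺`, for every admissible Poisson pair at each end (ENDPOINT COMPARISON — the open residual),
and (E) Cardy for the `t = 0` leg probabilities gives Cardy for the crude `G_s` site crossing (lattice end,
landed as `latticeEnd_holds` of the skeleton), then Cardy for annealed Poisson–Voronoi percolation implies Cardy
for site percolation on `G_s`.  Proof: Kingman existence of the `t = 1` laws and an `ε/2` argument. [folklore] -/
theorem dilutionEndpoint_transfer
    (h₁ : (∀ (PB PW : Measure (PointConfig ℂ)),
        IsPoissonPointProcess (volume : Measure ℂ) PB → IsPoissonPointProcess (volume : Measure ℂ) PW →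
        ∀ R : ConformalRectangle, R.HasCrossingLimit (voronoiCrossingProb PB PW R) cardyFunction) →
      ∀ (PB PW : Measure (PointConfig ℂ)),
        IsPoissonPointProcess (volume : Measure ℂ) PB → IsPoissonPointProcess (volume : Measure ℂ) PW →
        ∀ R : ConformalRectangle, R.HasCrossingLimit (legProb 1 PB PW R) cardyFunction)
    (hE : ∀ R : ConformalRectangle, ∀ ε > (0 : ℝ), ∀ᶠ δ in 𝓝[>] (0 : ℝ),
      ∀ (PB PW PB' PW' : Measure (PointConfig ℂ)),
        IsPoissonPointProcess (volume : Measure ℂ) PB → IsPoissonPointProcess (volume : Measure ℂ) PW →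
        IsPoissonPointProcess (0 : Measure ℂ) PB' → IsPoissonPointProcess (0 : Measure ℂ) PW' →
          |legProb 1 PB PW R δ - legProb 0 PB' PW' R δ| ≤ ε)
    (h₀ : (∀ (PB PW : Measure (PointConfig ℂ)),
        IsPoissonPointProcess (0 : Measure ℂ) PB → IsPoissonPointProcess (0 : Measure ℂ) PW →
        ∀ R : ConformalRectangle, R.HasCrossingLimit (legProb 0 PB PW R) cardyFunction) →
      ∀ R : ConformalRectangle, R.HasCrossingLimit (siteCrossingProb R) cardyFunction) :
    (∀ (PB PW : Measure (PointConfig ℂ)),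
        IsPoissonPointProcess (volume : Measure ℂ) PB → IsPoissonPointProcess (volume : Measure ℂ) PW →
        ∀ R : ConformalRectangle, R.HasCrossingLimit (voronoiCrossingProb PB PW R) cardyFunction) →
      ∀ R : ConformalRectangle, R.HasCrossingLimit (siteCrossingProb R) cardyFunction := by
  refine fun hV => h₀ ?_
  intro PB₀ PW₀ hPB₀ hPW₀ R φ x hφ
  obtain ⟨PB₁, hPB₁⟩ := exists_isPoissonPointProcess_volume
  obtain ⟨PW₁, hPW₁⟩ := exists_isPoissonPointProcess_volume
  have hlim₁ : Tendsto (legProb 1 PB₁ PW₁ R) (𝓝[>] 0) (𝓝 (cardyFunction (crossRatio x))) :=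
    h₁ hV PB₁ PW₁ hPB₁ hPW₁ R φ x hφ
  refine tendsto_of_eventually_abs_sub_le hlim₁ fun ε hε => ?_
  filter_upwards [hE R ε hε] with δ hδ
  exact hδ PB₁ PW₁ PB₀ PW₀ hPB₁ hPW₁ hPB₀ hPW₀

/-- **The crux factors through the two ends of the Poisson-dilution leg, BY NAME**: hypothesis end,
endpoint comparison and lattice end give `CardyFlipRusso.SquareFromVoronoiHub`
(`squareFromVoronoiHub_iff` + `dilutionEndpoint_transfer`). [folklore] -/
theorem squareFromVoronoiHub_of_dilutionEndpoint
    (h₁ : (∀ (PB PW : Measure (PointConfig ℂ)),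
        IsPoissonPointProcess (volume : Measure ℂ) PB → IsPoissonPointProcess (volume : Measure ℂ) PW →
        ∀ R : ConformalRectangle, R.HasCrossingLimit (voronoiCrossingProb PB PW R) cardyFunction) →
      ∀ (PB PW : Measure (PointConfig ℂ)),
        IsPoissonPointProcess (volume : Measure ℂ) PB → IsPoissonPointProcess (volume : Measure ℂ) PW →
        ∀ R : ConformalRectangle, R.HasCrossingLimit (legProb 1 PB PW R) cardyFunction)
    (hE : ∀ R : ConformalRectangle, ∀ ε > (0 : ℝ), ∀ᶠ δ in 𝓝[>] (0 : ℝ),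
      ∀ (PB PW PB' PW' : Measure (PointConfig ℂ)),
        IsPoissonPointProcess (volume : Measure ℂ) PB → IsPoissonPointProcess (volume : Measure ℂ) PW →
        IsPoissonPointProcess (0 : Measure ℂ) PB' → IsPoissonPointProcess (0 : Measure ℂ) PW' →
          |legProb 1 PB PW R δ - legProb 0 PB' PW' R δ| ≤ ε)
    (h₀ : (∀ (PB PW : Measure (PointConfig ℂ)),
        IsPoissonPointProcess (0 : Measure ℂ) PB → IsPoissonPointProcess (0 : Measure ℂ) PW →
        ∀ R : ConformalRectangle, R.HasCrossingLimit (legProb 0 PB PW R) cardyFunction) →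
      ∀ R : ConformalRectangle, R.HasCrossingLimit (siteCrossingProb R) cardyFunction) :
    Summit.CriticalPhenomena.CardyFormulaZ2.Theses.CardyFlipRusso.SquareFromVoronoiHub :=
  squareFromVoronoiHub_iff.2 (dilutionEndpoint_transfer h₁ hE h₀)

/-- **Registered glue `stub_dilutionEndpointGlue`** (skeleton v3 of the line): the crux, UNFOLDED by
`squareFromVoronoiHub_iff`, factors through hypothesis end, endpoint comparison and lattice end — the
statement of `dilutionEndpoint_transfer`. [folklore] -/
theorem stub_dilutionEndpointGlue : ((∀ (PB PW : Measure (PointConfig ℂ)),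
        IsPoissonPointProcess (volume : Measure ℂ) PB → IsPoissonPointProcess (volume : Measure ℂ) PW →
        ∀ R : ConformalRectangle, R.HasCrossingLimit (voronoiCrossingProb PB PW R) cardyFunction) →
      ∀ (PB PW : Measure (PointConfig ℂ)),
        IsPoissonPointProcess (volume : Measure ℂ) PB → IsPoissonPointProcess (volume : Measure ℂ) PW →
        ∀ R : ConformalRectangle, R.HasCrossingLimit (legProb 1 PB PW R) cardyFunction) →
    (∀ R : ConformalRectangle, ∀ ε > (0 : ℝ), ∀ᶠ δ in 𝓝[>] (0 : ℝ),
      ∀ (PB PW PB' PW' : Measure (PointConfig ℂ)),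
        IsPoissonPointProcess (volume : Measure ℂ) PB → IsPoissonPointProcess (volume : Measure ℂ) PW →
        IsPoissonPointProcess (0 : Measure ℂ) PB' → IsPoissonPointProcess (0 : Measure ℂ) PW' →
          |legProb 1 PB PW R δ - legProb 0 PB' PW' R δ| ≤ ε) →
    ((∀ (PB PW : Measure (PointConfig ℂ)),
        IsPoissonPointProcess (0 : Measure ℂ) PB → IsPoissonPointProcess (0 : Measure ℂ) PW →
        ∀ R : ConformalRectangle, R.HasCrossingLimit (legProb 0 PB PW R) cardyFunction) →
      ∀ R : ConformalRectangle, R.HasCrossingLimit (siteCrossingProb R) cardyFunction) →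
    ((∀ (PB PW : Measure (PointConfig ℂ)),
        IsPoissonPointProcess (volume : Measure ℂ) PB → IsPoissonPointProcess (volume : Measure ℂ) PW →
        ∀ R : ConformalRectangle, R.HasCrossingLimit (voronoiCrossingProb PB PW R) cardyFunction) →
      ∀ R : ConformalRectangle, R.HasCrossingLimit (siteCrossingProb R) cardyFunction) :=
  fun h₁ hE h₀ => dilutionEndpoint_transfer h₁ hE h₀

/-! ### Conversely: common crossing limits at the two ends ⟹ endpoint comparison -/

/-- Two real families converging to the same limit along a filter are eventually `ε`-close. [folklore] -/
theorem eventually_abs_sub_le_of_tendsto {f g : ℝ → ℝ} {l : Filter ℝ} {a : ℝ}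
    (hf : Tendsto f l (𝓝 a)) (hg : Tendsto g l (𝓝 a)) {ε : ℝ} (hε : 0 < ε) :
    ∀ᶠ x in l, |f x - g x| ≤ ε := by
  rw [Metric.tendsto_nhds] at hf hg
  filter_upwards [hf (ε / 2) (half_pos hε), hg (ε / 2) (half_pos hε)] with x hx hy
  rw [Real.dist_eq] at hx hy
  calc |f x - g x| = |(f x - a) - (g x - a)| := by ring_nf
    _ ≤ |f x - a| + |g x - a| := abs_sub _ _
    _ ≤ ε := by linarith

/-- **Common crossing limits at the two ends give the endpoint comparison** for every conformal rectangle
that admits a uniformizing datum `(φ, x)`: if the `t = 1` leg probabilities (every Poisson pair of intensity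
`volume`) and the `t = 0` leg probabilities (every Poisson pair of intensity `0`) both have crossing limit `F`
for `R`, they are eventually `ε`-close, uniformly over the admissible pairs — by Rényi–Kingman uniqueness
(`existsUnique_isPoissonPointProcess_holds`) there is exactly one admissible law at each end.  Hence, given
the two landed ends of the leg, the registered residual of skeleton v3 is implied by "Cardy at both ends", i.e.
it carries no content beyond the crux's own. [cite: Kingman1993, §2.5] -/
theorem endpointComparison_of_hasCrossingLimit (R : ConformalRectangle) (F : ℝ → ℝ)
    (hU : ∃ (φ : Literature.Probability.RandomPlanarGeometry.ConformalEquiv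
        UpperHalfPlane.upperHalfPlaneSet R.carrier) (x : Fin 4 → ℝ), R.IsUniformizing φ x)
    (h1 : ∀ (PB PW : Measure (PointConfig ℂ)),
        IsPoissonPointProcess (volume : Measure ℂ) PB → IsPoissonPointProcess (volume : Measure ℂ) PW →
        R.HasCrossingLimit (legProb 1 PB PW R) F)
    (h0 : ∀ (PB PW : Measure (PointConfig ℂ)),
        IsPoissonPointProcess (0 : Measure ℂ) PB → IsPoissonPointProcess (0 : Measure ℂ) PW →
        R.HasCrossingLimit (legProb 0 PB PW R) F) :
    ∀ ε > (0 : ℝ), ∀ᶠ δ in 𝓝[>] (0 : ℝ),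
      ∀ (PB PW PB' PW' : Measure (PointConfig ℂ)),
        IsPoissonPointProcess (volume : Measure ℂ) PB → IsPoissonPointProcess (volume : Measure ℂ) PW →
        IsPoissonPointProcess (0 : Measure ℂ) PB' → IsPoissonPointProcess (0 : Measure ℂ) PW' →
          |legProb 1 PB PW R δ - legProb 0 PB' PW' R δ| ≤ ε := by
  intro ε hε
  obtain ⟨φ, x, hφ⟩ := hU
  -- the unique admissible laws at the two ends
  obtain ⟨P₁, hP₁, huniq₁⟩ :=
    existsUnique_isPoissonPointProcess_holds (E := ℂ) (volume : Measure ℂ) (fun z => measure_singleton z)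
  obtain ⟨P₀, hP₀, huniq₀⟩ :=
    existsUnique_isPoissonPointProcess_holds (E := ℂ) (0 : Measure ℂ) (fun z => by simp)
  have hlim₁ : Tendsto (legProb 1 P₁ P₁ R) (𝓝[>] 0) (𝓝 (F (crossRatio x))) := h1 P₁ P₁ hP₁ hP₁ φ x hφ
  have hlim₀ : Tendsto (legProb 0 P₀ P₀ R) (𝓝[>] 0) (𝓝 (F (crossRatio x))) := h0 P₀ P₀ hP₀ hP₀ φ x hφ
  filter_upwards [eventually_abs_sub_le_of_tendsto hlim₁ hlim₀ hε] with δ hδ PB PW PB' PW' hPB hPW hPB' hPW'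
  rw [huniq₁ PB hPB, huniq₁ PW hPW, huniq₀ PB' hPB', huniq₀ PW' hPW']
  exact hδ

end Summit.CriticalPhenomena.CardyFormulaZ2.Cruxes.SquareFromVoronoiHub.PoissonDilutionLeg

end
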